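import Summits.AtomisticToContinuum.BoseEinsteinCondensation.Theorems.BECThomsonPrincipleGaussianDominationCanDefs
import HarnessLib

/-!
# Crux-strategist sketch — typed signatures for `STRATEGY-CENSUS.md` (crux `GaussianDominationCan`, stmt-AtomisticToContinuum-9479)

Statements only (`def … : Prop`), plus the trivial implications that place them relative to the crux.  Nothing here is a
line or a stub; these are the S⁺ / decomposition / route-level signatures the census argues about.
-/

noncomputable section

namespace Summit.AtomisticToContinuum.BoseEinsteinCondensation.Cruxes.GaussianDominationCan.Strategist

open MeasureTheory
open scoped ENNReal NNReal
open Literature.MathematicalPhysics.QuantumManyBody.BoseGas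
open Summit.AtomisticToContinuum.BoseEinsteinCondensation.Theses
open Summit.AtomisticToContinuum.BoseEinsteinCondensation.Theorems.GaussianDominationCan.Negative
  (GDIneq InWindow GDCanWith gaussianDominationCan_iff sourceIntegral nsq)
open Summit.AtomisticToContinuum.BoseEinsteinCondensation.Cruxes.GaussianDominationCan.CouplingMonotoneChord
  (GDChordBody modeCoeff trunc scalePot)

/-! ## §R Route-level: the GERM of the crux (all that `closes` consumes) -/

/-- `GDCanWith` in GERM form: the chord only for `0 ≤ s ≤ s₀`, with `s₀ = s₀(m, L, n) > 0` chosen AFTER the data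
(linear response of the exact ground state plus a little uniformity; no non-linear regime). -/
def GDCanGermWith (ρ₀ C : ℝ) (N₀ : ℕ) (v : ℝ → ℝ≥0∞) (M : ℝ) : Prop :=
  ∀ m : ℕ, N₀ ≤ m + 1 → ∀ L : ℝ, 0 < L → ((m + 1 : ℕ) : ℝ) ≤ ρ₀ * L ^ 3 →
    ∀ n : Fin 3 → ℤ, n ≠ 0 → InWindow M m L n → ∃ s₀ : ℝ, 0 < s₀ ∧ ∀ s : ℝ, 0 ≤ s → s ≤ s₀ →
      ∀ Φ : PeriodicTrialState (m + 1) L, GDIneq v m L n C s Φ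

/-- **GDCanGerm** — the crux restricted to its germ at `s = 0`. Recommended re-typing of item 9479 (tenure): it is what the
flow mechanism (Thomson duality at `s = 0`) can reach and all that `GDTransfer` (variational KLS, `t → 0`) consumes. -/
def GDCanGerm : Prop :=
  ∀ v : ℝ → ℝ≥0∞, IsRepulsiveFiniteRange v → ∀ M : ℝ, 0 < M →
    ∃ ρ₀ C : ℝ, 0 < ρ₀ ∧ 0 < C ∧ ∃ N₀ : ℕ, GDCanGermWith ρ₀ C N₀ v M

/-- The crux implies its germ (take `s₀ = 1`). [folklore] -/
theorem gdCanGerm_of_gdCan (h : BECThomsonPrinciple.GaussianDominationCan) : GDCanGerm := by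
  intro v hv M hM
  obtain ⟨ρ₀, C, hρ₀, hC, N₀, hG⟩ := gaussianDominationCan_iff.mp h v hv M hM
  exact ⟨ρ₀, C, hρ₀, hC, N₀, fun m hm L hL hd n hn hw =>
    ⟨1, one_pos, fun s hs _ Φ => hG m hm L hL hd n hn hw s hs Φ⟩⟩

/-- **ChordAutomatic** (drefute item 7; provable now from `ThetaNorm` + cell Bessel): for `s ≥ 2√N‖n‖²/(CL²) = √N k∞²/(2π²C)`,
i.e. `C s L² / ‖n‖² ≥ 2√(m+1)`, the chord is automatic for every `v` and every `Φ` (`2N|I| ≤ 2√N`).  So the crux's `∀ s` has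
content only below that scale; together with the germ this brackets the genuinely non-linear regime
`s₀ ≪ s ≲ √N k²` (phase-modulated condensates, `Disproof.lean` §E.11). -/
def ChordAutomatic : Prop :=
  ∀ v : ℝ → ℝ≥0∞, ∀ m : ℕ, ∀ L : ℝ, 0 < L → ∀ n : Fin 3 → ℤ, n ≠ 0 → ∀ C s : ℝ, 0 < C →
    2 * Real.sqrt ((m + 1 : ℕ) : ℝ) ≤ C * s * L ^ 2 / ‖(fun j => (n j : ℝ))‖ ^ 2 →
      ∀ Φ : PeriodicTrialState (m + 1) L, GDIneq v m L n C s Φ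

/-! ## §S Strengthenings S⁺ considered -/

/-- **S⁺₁ ParticleMonotoneChord** (lens `strengthen`, induction on `N` at fixed side `L` and mode `n`): a chord constant valid for
`N` particles is valid for `N + 1` (anchor `N = 1` is the free chord, no pair term).  Bogoliubov: `k²χ_Λ/2 = (k²+μ)/(k²+2μ)`,
`μ = 8πaN/L³`, is DECREASING in `N` — consistent.  Crux-plus (gives the sharp constant by induction) and a mixed third-derivative
sign `∂_N∂_s²E₀ ≤ 0` of the same supermodularity class as B; no mechanism. -/
def ParticleMonotoneChord : Prop :=
  ∀ v : ℝ → ℝ≥0∞, IsRepulsiveFiniteRange v → ∀ M : ℝ, 0 < M → ∃ ρ₀ : ℝ, 0 < ρ₀ ∧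
    ∀ m : ℕ, ∀ L : ℝ, 0 < L → ((m + 2 : ℕ) : ℝ) ≤ ρ₀ * L ^ 3 →
      ∀ n : Fin 3 → ℤ, n ≠ 0 → 2 * Real.pi * ‖(fun j => (n j : ℝ))‖ / L ≤ M * Real.sqrt ρ₀ →
        ∀ C : ℝ, 0 < C → GDChordBody v C m L n → GDChordBody v C (m + 1) L n

/-- **S⁺₂ ExcessControlsMode** (operator one-mode infrared bound; also leaf 2 of split D2): the excess energy of ANY trial state
pays `ε₀k²` per particle in mode `k` above a floor `n̄ = K√ρ/k∞`:
`E₀ + ε₀ k² · N ∫|ĉ_k|² ≤ E(Φ) + ε₀ k² n̄` (`N∫|ĉ_k|² = ⟨n_k⟩_Φ` by Bose symmetry).  Free gas: `ε₀ = 1`, `n̄ = 0` (`ModeBessel`).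
Interacting: true at Bogoliubov level (`e_k/(u_k+v_k)² = k²`, `n_k(Ψ₀) ≈ √(2μ)/(4k)`), but it bounds `n_k(Ψ₀) ≤ n̄` uniformly in
`L` at `T = 0` — a one-mode IR bound, in print only via RP + KLS (barrier `HalfFillingReflectionPositivity`); behind the wall. -/
def ExcessControlsMode : Prop :=
  ∀ v : ℝ → ℝ≥0∞, IsRepulsiveFiniteRange v → ∀ M : ℝ, 0 < M →
    ∃ ρ₀ ε₀ K : ℝ, 0 < ρ₀ ∧ 0 < ε₀ ∧ 0 < K ∧ ∃ N₀ : ℕ,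
      ∀ m : ℕ, N₀ ≤ m + 1 → ∀ L : ℝ, 0 < L → ((m + 1 : ℕ) : ℝ) ≤ ρ₀ * L ^ 3 →
        ∀ n : Fin 3 → ℤ, n ≠ 0 → InWindow M m L n → ∀ Φ : PeriodicTrialState (m + 1) L,
          periodicGroundStateEnergy v (m + 1) L +
              ENNReal.ofReal (ε₀ * (4 * Real.pi ^ 2 * nsq n / L ^ 2) * (m + 1 : ℝ)) *
                ∫⁻ X in cellN (m + 1) L, (‖modeCoeff m L n Φ.ψ X‖₊ : ℝ≥0∞) ^ 2 ≤
            periodicEnergy v Φ +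
              ENNReal.ofReal (ε₀ * (4 * Real.pi ^ 2 * nsq n / L ^ 2) *
                (K * Real.sqrt ((m + 1 : ℕ) / L ^ 3) * L / (2 * Real.pi * ‖(fun j => (n j : ℝ))‖)))

/-- **QuantGerm** (leaf 1 of split D2): the crux's chord on the MESOSCOPIC ray `s² ≤ K' k∞³ √ρ` (`≍ k⁴ n̄`: coherent
displacements `|z| ≲ √n̄` of mode `k`, `N`-independent).  It contains the whole `T = 0` linear-response content of the crux
(`s → 0`: `k²χ_Λ/2 → ρ/(2ρ_s)` in the thermodynamic corner) — the summit-strength leaf. -/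
def QuantGerm : Prop :=
  ∀ v : ℝ → ℝ≥0∞, IsRepulsiveFiniteRange v → ∀ M : ℝ, 0 < M →
    ∃ ρ₀ C K' : ℝ, 0 < ρ₀ ∧ 0 < C ∧ 0 < K' ∧ ∃ N₀ : ℕ,
      ∀ m : ℕ, N₀ ≤ m + 1 → ∀ L : ℝ, 0 < L → ((m + 1 : ℕ) : ℝ) ≤ ρ₀ * L ^ 3 →
        ∀ n : Fin 3 → ℤ, n ≠ 0 → InWindow M m L n → ∀ s : ℝ, 0 ≤ s →
          s ^ 2 ≤ K' * (2 * Real.pi * ‖(fun j => (n j : ℝ))‖ / L) ^ 3 * Real.sqrt ((m + 1 : ℕ) / L ^ 3) →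
            ∀ Φ : PeriodicTrialState (m + 1) L, GDIneq v m L n C s Φ

/-- **Split D2 (glue, proved on paper in the census §Decomposition; not filed)**: mode borrowing
`2N|I| ≤ t·N∫|ĉ_k|² + 1/t` (Cauchy–Schwarz + `ThetaNorm`, both landed) with `st = ε₀k²` turns `ExcessControlsMode` into the
chord for `s² ≥ ε₀ k² k∞² n̄/(C − 1/ε₀)`, and `QuantGerm` (with `K'` matched to `ε₀, K, C`) covers the rest. -/
def SplitD2 : Prop :=
  QuantGerm → ExcessControlsMode → BECThomsonPrinciple.GaussianDominationCan

/-! ## §T Transfer from the solved sibling (Gross–Pitaevskii corner) -/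

/-- **GPAnchor** (lens `transfer`): the crux restricted to the top corner of its admissible region, `L ≥ M²N/(4π²K)` (then
`Na/L ≤ 4π²aK/M²`: Gross–Pitaevskii scaling on the torus, where Bogoliubov theory is a theorem — BBCS arXiv:1801.01389,
LSSY2005 Thm 5.3).  Provable in principle by transferring BBCS; XXL in Lean. -/
def GPAnchor : Prop :=
  ∀ v : ℝ → ℝ≥0∞, IsRepulsiveFiniteRange v → ∀ M K : ℝ, 0 < M → 0 < K →
    ∃ ρ₀ C : ℝ, 0 < ρ₀ ∧ 0 < C ∧ ∃ N₀ : ℕ,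
      ∀ m : ℕ, N₀ ≤ m + 1 → ∀ L : ℝ, 0 < L → ((m + 1 : ℕ) : ℝ) ≤ ρ₀ * L ^ 3 →
        M ^ 2 * ((m + 1 : ℕ) : ℝ) / (4 * Real.pi ^ 2 * K) ≤ L →
          ∀ n : Fin 3 → ℤ, n ≠ 0 → InWindow M m L n → ∀ s : ℝ, 0 ≤ s →
            ∀ Φ : PeriodicTrialState (m + 1) L, GDIneq v m L n C s Φ

/-- **ScaleExtension** (the first NON-transferring step, typed): the optimal chord constant does not deteriorate as the side
`L` DECREASES at fixed `N` and fixed lattice momentum `n` (from the GP corner down to `L = (N/ρ₀)^{1/3}`).  On the unit torus this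
is antitonicity along the ZOOM family `w_L(y) = L²v(Ly)` (scattering length `a/L` increasing as `L` decreases): the same
supermodularity class as B with a family that is not even pointwise monotone (virial derivative `2v + rv'` has no sign) —
crux-plus, no mechanism.  `GPAnchor ∧ ScaleExtension ⇒ crux` is immediate. -/
def ScaleExtension : Prop :=
  ∀ v : ℝ → ℝ≥0∞, IsRepulsiveFiniteRange v → ∀ M : ℝ, 0 < M → ∃ ρ₀ : ℝ, 0 < ρ₀ ∧
    ∀ m : ℕ, ∀ L L' : ℝ, 0 < L → L ≤ L' → ((m + 1 : ℕ) : ℝ) ≤ ρ₀ * L ^ 3 →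
      ∀ n : Fin 3 → ℤ, n ≠ 0 → InWindow M m L n →
        ∀ C : ℝ, 0 < C → GDChordBody v C m L' n → GDChordBody v C m L n

/-- The crux restricts to the GP corner. [folklore] -/
theorem gpAnchor_of_gdCan (h : BECThomsonPrinciple.GaussianDominationCan) : GPAnchor := by
  intro v hv M K hM _
  obtain ⟨ρ₀, C, hρ₀, hC, N₀, hG⟩ := gaussianDominationCan_iff.mp h v hv M hM
  exact ⟨ρ₀, C, hρ₀, hC, N₀, fun m hm L hL hd _ n hn hw s hs Φ => hG m hm L hL hd n hn hw s hs Φ⟩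

end Summit.AtomisticToContinuum.BoseEinsteinCondensation.Cruxes.GaussianDominationCan.Strategist

end
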